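import Literature.AnabelianGeometry.EtaleTheta.Discharge.Sec3Thm37OfRankOnePointR
import Literature.AnabelianGeometry.EtaleTheta.Discharge.Sec3Cor38OfGaloisCoveringConnectedR
import HarnessLib

/-!
# [EtTh] Theorem 3.7 (i)–(iv), monoid type `Λ = ℝ`, with NO binder at the one-component constructed tempered Frobenioid

S. Mochizuki, *The étale theta function and its Frobenioid-theoretic manifestations*, Publ. RIMS **45** (2009), Thm. 3.7
(i)–(iv) PDF pp. 79–80, Prop. 3.4 (ii) p. 74, Def. 3.6 (i)/(ii) pp. 76–77 [cite: MochizukiEtTh2009, Thm 3.7 p.79].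

abc-iut cell, layer L2, node `EtTh:Thm3.7`, seat abc-iut-L2-d2 (gen 5).  PROOF-ONLY (0 definitions).  abc-iut-w6-d061's `Λ = ℝ` END
KNIT at the constructed data `TemperedFrobenioid.thm37_ofRankOnePointR_of_inputs` (p448135; `hBmon`, `hD`, `hnd`, `hrat` discharged at
every rank-one point of abc-iut-w6-d058's connected Def. 3.3 (iii) data) leaves exactly the three `D₀`-level clauses of Prop. 3.4
(ii) as binders: `h₀ : Prop34Cnst₀ cnst`, `hE` (clause 1 at `Λ = ℝ`), `hcyc`.  At abc-iut-w6-d048's ONE-COMPONENT model (`oneComp U hU`: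
smooth reduction, one component, no cusps; `OneCompFrd.temperedFrobenioidR U hU R S`, p447026) all three are THEOREMS:
* `hcyc` := this seat's `OneCompFrd.prop34Const_dm.hcyc` (p449874: `div₀(c) = [F]^{v(c)}`);
* `hE` := this seat's `OneCompFrd.effRealSpan_dm` (p450744: `Φ₀^birat = Φ₀^cnst`);
* `h₀` := `OneCompFrd.prop34Cnst₀_dm` HERE, for ANY constant-field functor `cnst` out of the connected `1`-sets (between two
  one-point `1`-sets there is exactly one morphism, `OneCompFrd.hom_eq`, so every naturality / faithfulness clause is trivial);
hence **`OneCompFrd.thm37_temperedFrobenioidR R S` — [EtTh] Thm. 3.7 (i) (unit-trivial, isotropic, model, birationally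
Frobenius-normalized, sub-quasi-Frobenius-trivial, not group-like) ∧ (ii) (standard ∧ rationally standard) ∧ (iii) (first clause,
`D^cnst := 𝓑(1)⁰`, `cnst` the constant functor at `1/1`) ∧ (iv), AS TYPED, with NO hypothesis at a NON-DEGENERATE constructed
tempered Frobenioid of monoid type `ℝ`** (and `thm37_temperedFrobenioidR₁` at the parameter-free instance `U := PUnit`).

HONEST LABEL: an instantiation / consistency certificate (the witness lives over ONE point of `D₀`, the `p`-adic Frobenioid of the
base field, [FrdII] Ex. 1.1; degenerate `D^cnst`); refereed pre-IUT material; nothing here bears on [IUTchIII] Cor. 3.12; no side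
taken; typed ≠ proved for the `D₀`-clauses at other models.
-/

noncomputable section

namespace Literature.AnabelianGeometry.EtaleTheta

open CategoryTheory Opposite Function Literature.AlgebraicGeometry.Frobenioids
  Literature.AnabelianGeometry.SemiGraphs LogDivisorModel LogDivisorModel.GaloisAction

namespace OneCompFrd

variable (U : Type) [CommGroup U] (hU : ∀ u : U, (∀ N : ℕ+, ∃ g : U, g ^ (N : ℕ) = u) → u = 1)

/-- Between two connected `1`-sets (one-point sets) there is exactly one morphism. [cite: MochizukiEtTh2009, Def 3.3 p.73] -/
theorem hom_eq {Y Y' : D₀} (g g' : Y ⟶ Y') : g = g' := by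
  refine InducedCategory.hom_ext (Action.hom_ext _ _ ?_)
  ext s
  exact eq_of_isConnectedGSet_punit Y'.property _ _

/-- **The `B₀`-level Prop. 3.4 (ii) naturality structure `Prop34Cnst₀` HOLDS at the one-component data for EVERY `cnst`** (all hom-sets
of the base are singletons). [cite: MochizukiEtTh2009, Prop 3.4 (ii) p.74] -/
theorem prop34Cnst₀_dm {Dc : Type*} [Category Dc] (cnst : D₀ ⥤ Dc) : (dm U hU).Prop34Cnst₀ cnst where
  B₀_map_eq_of_cnst_map_eq g g' _ b _ := by rw [hom_eq g g']
  Φ₀_map_eq_of_cnst_map_eq g g' _ x _ := by rw [hom_eq g g']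
  cnst_map_eq_of_B₀_map_eq g g' _ := by rw [hom_eq g.hom g'.hom]

variable (R S : ((Discrete PUnit.{1})ᵒᵖ ⥤ CommMonCat.{0}) → Prop)

/-- **[EtTh] Theorem 3.7 (i)–(iv), monoid type `ℝ`, with NO binder at the one-component constructed tempered Frobenioid**
`OneCompFrd.temperedFrobenioidR U hU R S`: abc-iut-w6-d061's `thm37_ofRankOnePointR_of_inputs` with `h₀ := prop34Cnst₀_dm`, `hE :=
effRealSpan_dm`, `hcyc := prop34Const_dm.hcyc`. [cite: MochizukiEtTh2009, Thm 3.7 p.79] -/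
theorem thm37_temperedFrobenioidR :
    (PreFrobenioid.IsOfType (PreFrobenioid.IsUnitTrivial (temperedFrobenioidR U hU R S).toElem) ∧
      PreFrobenioid.IsOfIsotropicType (temperedFrobenioidR U hU R S).toElem ∧
      PreFrobenioid.IsOfModelType (temperedFrobenioidR U hU R S).toElem
        ((temperedFrobenioidR U hU R S).isFrobenioid_treeCatVocab_of_isMonoidOn
          (TemperedFrobenioid.isMonoidOn_ratFnFunctor_ofRankOnePointR (cuspLaws_oneComp U hU) (rankOnePoint U hU)
            (hpfCof_oneComp U hU) R S))
        (PreFrobenioid.hasBiratSquares_of_isFrobenioid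
          ((temperedFrobenioidR U hU R S).isFrobenioid_treeCatVocab_of_isMonoidOn
            (TemperedFrobenioid.isMonoidOn_ratFnFunctor_ofRankOnePointR (cuspLaws_oneComp U hU) (rankOnePoint U hU)
              (hpfCof_oneComp U hU) R S))) ∧
      PreFrobenioidData.IsOfBiratFrobeniusNormalizedType
        (PreFrobenioid.biratData
          ((temperedFrobenioidR U hU R S).isFrobenioid_treeCatVocab_of_isMonoidOn
            (TemperedFrobenioid.isMonoidOn_ratFnFunctor_ofRankOnePointR (cuspLaws_oneComp U hU) (rankOnePoint U hU)
              (hpfCof_oneComp U hU) R S))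
          (PreFrobenioid.hasBiratSquares_of_isFrobenioid
            ((temperedFrobenioidR U hU R S).isFrobenioid_treeCatVocab_of_isMonoidOn
              (TemperedFrobenioid.isMonoidOn_ratFnFunctor_ofRankOnePointR (cuspLaws_oneComp U hU) (rankOnePoint U hU)
                (hpfCof_oneComp U hU) R S)))) ∧
      PreFrobenioid.IsOfType (PreFrobenioid.IsSubQuasiFrobeniusTrivial (temperedFrobenioidR U hU R S).toElem) ∧
      ¬ PreFrobenioid.IsOfType (PreFrobenioid.IsGroupLikeObj (temperedFrobenioidR U hU R S).toElem)) ∧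
    ((ModelFrobenioid.data (temperedFrobenioidR U hU R S).divisorMonoid (temperedFrobenioidR U hU R S).ratFnFunctor
        (temperedFrobenioidR U hU R S).divBNatTrans).IsOfStandardType ∧
      (PreFrobenioidData.ofFunctor (temperedFrobenioidR U hU R S).divisorMonoid
          (temperedFrobenioidR U hU R S).toElem).IsOfRationallyStandardType
        (PreFrobenioid.rsParams
          ((temperedFrobenioidR U hU R S).isFrobenioid_treeCatVocab_of_isMonoidOn
            (TemperedFrobenioid.isMonoidOn_ratFnFunctor_ofRankOnePointR (cuspLaws_oneComp U hU) (rankOnePoint U hU)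
              (hpfCof_oneComp U hU) R S))
          fun a 𝔭 => PrimarySupp a 𝔭)) ∧
    (∀ X : (temperedFrobenioidR U hU R S).category,
      FrobenioidFacade.AutActionFactorsThrough ((temperedFrobenioidR U hU R S).base ⋙ (Functor.const D₀).obj (CosetCat.top : CosetCat PUnit.{1})) (temperedFrobenioidR U hU R S).toElem X) ∧
    (temperedFrobenioidR U hU R S).Thm37_iv :=
  TemperedFrobenioid.thm37_ofRankOnePointR_of_inputs (cuspLaws_oneComp U hU) (rankOnePoint U hU) (hpfCof_oneComp U hU) R S
    ((Functor.const D₀).obj (CosetCat.top : CosetCat PUnit.{1})) (prop34Cnst₀_dm U hU _) (fun Y b x hb hbx => effRealSpan_dm U hU Y b x hb hbx) (prop34Const_dm U hU).hcyc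

/-- The same at abc-iut-w6-d048's PARAMETER-FREE instance `U := PUnit` (the value-group shadow `L^×/O_L^×`): [EtTh] Thm. 3.7 (iv) with no
binder and no model parameter. [cite: MochizukiEtTh2009, Thm 3.7 p.80] -/
theorem thm37_iv_temperedFrobenioidR₁ :
    (temperedFrobenioidR PUnit.{1} (fun _ _ => Subsingleton.elim _ _) R S).Thm37_iv :=
  (thm37_temperedFrobenioidR PUnit.{1} _ R S).2.2.2

end OneCompFrd

end Literature.AnabelianGeometry.EtaleTheta

end
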